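import Literature.NumberTheory.GaloisRepresentations.HeckeCharacterDictionary
import Literature.NumberTheory.GaloisRepresentations.HeckeCharacterRamificationProofs
import Literature.NumberTheory.GaloisRepresentations.ArtinReciprocityCharacterProofs
import Literature.NumberTheory.Automorphic.HilbertPartialHasseWeightShiftingProofs
import Literature.NumberTheory.LFunctions.RayClasses
import Mathlib.NumberTheory.NumberField.Completion.InfinitePlace
import Mathlib.NumberTheory.Padics.Complex
import Mathlib.Analysis.Normed.Group.Ultra
import Mathlib.Analysis.SpecialFunctions.Pow.Continuity
import Mathlib.Analysis.SpecialFunctions.Complex.Log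
import HarnessLib

/-!
# Algebraic Hecke characters: infinity type on the totally positive ideles, modules of definition,
# the Größencharakter on the ray, and its `ℓ`-adic congruences (proved)

Topic `NumberTheory/GaloisRepresentations`; namespace
`Literature.NumberTheory.GaloisRepresentations`.  Proof file (theorems, with the auxiliary
definitions `InfiniteIdele.IsTotallyPositive`, `InfiniteIdele.root`, `HeckeCharacter.archFactor`,
`HeckeCharacter.HasInfinityType`, `oneUnitsLE`); no named fact, no instance (D-0026).  First half of
the tree's proof of **Weil's theorem** — the `ℓ`-adic character of an algebraic Hecke character
(A. Weil, *On a certain type of characters of the idèle-class group of an algebraic number-field*,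
1956; Serre, *Abelian ℓ-adic representations* (1968), Ch. II §2.4–2.8) — which is the case `n = 1`
of Harris–Lan–Taylor–Thorne's Theorem A / Theorem 7.13 ("in the case `n = 1` the result is well
known", Res. Math. Sci. 3:37 (2016), p. 232); the finite-order case is the tree's
`HeckeCharacter.exists_lAdic_of_isFiniteOrder` (`HeckeCharacterGaloisAvatarProofs`).

The tree's predicate `HeckeCharacter.IsAlgebraic χ` (Weil's type `A₀`, `HeckeCharacter.lean`) says:
for some integers `p_w, q_w` and some neighbourhood `U` of `1` in `(K ⊗ ℝ)ˣ`,
`χ((x, 1)) = ∏_w ι_w(x_w)^{-p_w} \overline{ι_w(x_w)}^{-q_w}` for `x ∈ U` (`HasInfinityType χ p q`).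

* §1–§2 `HeckeCharacter.HasInfinityType.apply_infiniteIdeles_eq` — **the formula holds on the whole
  group `(K ⊗ ℝ)ˣ_{>0}` of totally positive infinite ideles**: a totally positive `x` has `n`-th roots
  `y_n → 1` (`InfiniteIdele.exists_pow_eq_tendsto_one`), so `y_n ∈ U` for `n` large and
  `χ(x) = χ(y_n)^n = A(y_n)^n = A(x)` (both sides multiplicative, `archFactor`).  In particular
  `apply_globalToInfiniteUnits_eq`: for a totally positive `k ∈ Kˣ`,
  `χ((k)_∞) = ∏_w σ_w(k)^{-p_w} \overline{σ_w(k)}^{-q_w}` (`σ_w` the embedding of `w`).  Weil 1956 §1;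
  Neukirch, *Algebraic Number Theory*, VII (6.7)–(6.9).
* §3 `HeckeCharacter.exists_isModulus_of_ramified` — **every Hecke character has a module of
  definition `(T, e)` supported on its ramified places** (`HeckeCharacter.IsModulus`; Neukirch VII §6
  after Def. (6.11); Tate's no-small-subgroups argument, tree `ideleGroup_exists_congruenceSubgroup_subset`,
  `eq_one_of_norm_pow_sub_one_le`, `IsModulus.of_isUnramifiedAt`).
* §4 `HeckeCharacter.HasInfinityType.idealPow_span_eq` — **the Größencharakter on the ray**: with
  `χ̃(𝔞) = ∏_𝔭 χ(ϖ_𝔭)^{v_𝔭(𝔞)}` (`LFunctions.idealPow` of `v ↦ χ(ϖ_v)`) and `𝔪 = ∏_{v ∈ T} 𝔭_v^{e_v+1}`,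
  for nonzero integers `b ≡ c mod 𝔪`, `c` prime to `𝔪`, `b/c` totally positive:
  `χ̃((b)) = χ̃((c)) ∏_w σ_w(b/c)^{p_w} \overline{σ_w(b/c)}^{q_w}` — Neukirch's decomposition of principal
  ideles (VII (6.13), tree `map_principalIdele_eq`, exactly as in `isRayClassCharacter_of_isModulus`)
  with the infinite parts now differing by `χ((b/c)_∞) = A((b/c)_∞)`.  Neukirch VII (6.13)–(6.14).
* §5 `norm_ιsymm_archRatio_sub_one_le` — **the `ℓ`-adic congruence**: if moreover `c` is prime to
  `ℓ` and `b ≡ c mod ℓ^N` (`N ≥ 1`), then for every `ι : ℚ̄_ℓ ≃+* ℂ` the `ℓ`-adic number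
  `ι⁻¹(∏_w σ_w(b/c)^{p_w} \overline{σ_w(b/c)}^{q_w})` is a one-unit of level `‖ℓ‖^N`
  (`oneUnitsLE`): each factor is `τ(b/c)^{±1}` for an embedding `τ : K → ℚ̄_ℓ`, and
  `‖τ(b/c) - 1‖ ≤ ‖ℓ‖^N` (`norm_embedding_div_sub_one_le`: integers have norm `≤ 1`, integers prime
  to `ℓ` are units).  This is what makes `𝔞 ↦ ι⁻¹(χ̃(𝔞)) mod ℓ^N` a character of the ray class
  group modulo `𝔪 ℓ^N ∞` (Weil 1956 §2; Serre 1968 Ch. II §2.7–2.8).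

## References

* A. Weil, *On a certain type of characters of the idèle-class group of an algebraic
  number-field*, Proc. Int. Symp. Tokyo–Nikko 1955 (1956), 1–7, §1–§2. [Weil1956]
* J.-P. Serre, *Abelian ℓ-adic representations and elliptic curves* (1968), Ch. II §2.4, §2.7–2.8.
  [SerreAbelianLadic1968]
* J. Neukirch, *Algebraic Number Theory* (1999), Ch. VII §6, (6.7)–(6.9), Def. (6.11)–(6.14).
  [NeukirchANT1999]
* M. Harris, K.-W. Lan, R. Taylor, J. Thorne, Res. Math. Sci. 3:37 (2016), Thm. 7.13, p. 232.
  [HarrisLanTaylorThorneRMS2016]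
-/

noncomputable section

open scoped NumberField Topology ComplexConjugate Classical
open NumberField IsDedekindDomain Filter NumberField.InfinitePlace NumberField.InfinitePlace.Completion

namespace Literature.NumberTheory.GaloisRepresentations

universe u

/-! ### §0. Coordinates of infinite adeles

`InfiniteAdeleRing K` is a (non-reducible) `def` for `Π_{w ∣ ∞} K_w`, so the `Pi` lemmas do not
fire under `rw`/`simp`; we restate the coordinate formulas on the nose (all `rfl`). -/

namespace InfiniteAdeleRing

variable {K : Type u} [Field K]

/-- `(a b)_w = a_w b_w`. [folklore] -/
theorem mul_apply' (a b : InfiniteAdeleRing K) (w : InfinitePlace K) : (a * b) w = a w * b w := rfl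

/-- `1_w = 1`. [folklore] -/
@[simp] theorem one_apply' (w : InfinitePlace K) : (1 : InfiniteAdeleRing K) w = 1 := rfl

/-- `(aⁿ)_w = a_wⁿ`. [folklore] -/
theorem pow_apply' (a : InfiniteAdeleRing K) (n : ℕ) (w : InfinitePlace K) : (a ^ n) w = a w ^ n := rfl

end InfiniteAdeleRing

variable {K : Type u} [Field K]

/-! ### §1. Totally positive infinite ideles and their roots -/

namespace InfiniteIdele

/-- An infinite idele `x ∈ (K ⊗ ℝ)ˣ = ∏_{w ∣ ∞} K_wˣ` is **totally positive** if its coordinate at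
every real place is positive (the identity component `(K ⊗ ℝ)ˣ_{>0}` of `(K ⊗ ℝ)ˣ`).
Ref: Neukirch, *Algebraic Number Theory*, Ch. VII §6 (before (6.8): `𝐑^*_{(+)}`). [folklore] -/
def IsTotallyPositive (x : (InfiniteAdeleRing K)ˣ) : Prop :=
  ∀ (w : InfinitePlace K) (hw : w.IsReal), 0 < extensionEmbeddingOfIsReal hw ((x : InfiniteAdeleRing K) w)

/-- Unfolding lemma for `IsTotallyPositive`. [folklore] -/
theorem isTotallyPositive_iff (x : (InfiniteAdeleRing K)ˣ) :
    IsTotallyPositive x ↔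
      ∀ (w : InfinitePlace K) (hw : w.IsReal), 0 < extensionEmbeddingOfIsReal hw ((x : InfiniteAdeleRing K) w) :=
  Iff.rfl

/-- A coordinate of an infinite idele is nonzero. [folklore] -/
theorem coe_apply_ne_zero (x : (InfiniteAdeleRing K)ˣ) (w : InfinitePlace K) :
    (x : InfiniteAdeleRing K) w ≠ 0 := by
  intro h
  have h1 : ((x * x⁻¹ : (InfiniteAdeleRing K)ˣ) : InfiniteAdeleRing K) w = 1 := by
    rw [mul_inv_cancel, Units.val_one]; rfl
  rw [Units.val_mul, InfiniteAdeleRing.mul_apply', h, zero_mul] at h1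
  exact zero_ne_one h1

/-- The complex coordinate `ι_w(x_w)` of an infinite idele is nonzero. [folklore] -/
theorem extensionEmbedding_apply_ne_zero (x : (InfiniteAdeleRing K)ˣ) (w : InfinitePlace K) :
    extensionEmbedding w ((x : InfiniteAdeleRing K) w) ≠ 0 :=
  (map_ne_zero _).mpr (coe_apply_ne_zero x w)

/-- The canonical `n`-th root of a totally positive infinite idele, coordinatewise: the positive
real `n`-th root at a real place, `exp(log z / n)` (principal branch) at a complex place. [folklore] -/
def root (n : ℕ) (x : (InfiniteAdeleRing K)ˣ) : InfiniteAdeleRing K := fun w =>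
  if hw : w.IsReal then
    (ringEquivRealOfIsReal hw).symm
      ((extensionEmbeddingOfIsReal hw ((x : InfiniteAdeleRing K) w)) ^ ((n : ℝ)⁻¹))
  else
    (ringEquivComplexOfIsComplex (not_isReal_iff_isComplex.mp hw)).symm
      (Complex.exp (Complex.log (extensionEmbedding w ((x : InfiniteAdeleRing K) w)) / n))

/-- `(root n x)^n = x` for `n ≥ 1` and `x` totally positive. [folklore] -/
theorem root_pow {n : ℕ} (hn : 0 < n) {x : (InfiniteAdeleRing K)ˣ} (hx : IsTotallyPositive x) :
    root n x ^ n = (x : InfiniteAdeleRing K) := by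
  funext w
  simp only [InfiniteAdeleRing.pow_apply', root]
  split_ifs with hw
  · rw [← map_pow, Real.rpow_inv_natCast_pow (hx w hw).le hn.ne']
    apply (ringEquivRealOfIsReal hw).injective
    rw [RingEquiv.apply_symm_apply, ringEquivRealOfIsReal_apply]
  · have hc := not_isReal_iff_isComplex.mp hw
    rw [← map_pow, ← Complex.exp_nat_mul, mul_div_cancel₀ _ (Nat.cast_ne_zero.mpr hn.ne'),
      Complex.exp_log (extensionEmbedding_apply_ne_zero x w)]
    apply (ringEquivComplexOfIsComplex hc).injective
    rw [RingEquiv.apply_symm_apply, ringEquivComplexOfIsComplex_apply]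

/-- `root n x → 1` as `n → ∞` (positive real roots `t^{1/n} → 1`, `exp(log z / n) → 1`).
[folklore] -/
theorem tendsto_root (x : (InfiniteAdeleRing K)ˣ) (hx : IsTotallyPositive x) :
    Tendsto (fun n => root n x) atTop (𝓝 1) := by
  refine tendsto_pi_nhds.mpr fun w => ?_
  by_cases hw : w.IsReal
  · simp only [root, dif_pos hw, InfiniteAdeleRing.one_apply']
    have h1 : (1 : w.Completion) = (isometryEquivRealOfIsReal hw).symm 1 := by
      apply (isometryEquivRealOfIsReal hw).injective
      rw [IsometryEquiv.apply_symm_apply]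
      exact map_one (ringEquivRealOfIsReal hw)
    rw [h1]
    refine ((isometryEquivRealOfIsReal hw).symm.continuous.tendsto _).comp ?_
    set t : ℝ := extensionEmbeddingOfIsReal hw ((x : InfiniteAdeleRing K) w) with ht
    have hcont : ContinuousAt (fun s : ℝ => t ^ s) 0 := Real.continuousAt_const_rpow (hx w hw).ne'
    have h0 : Tendsto (fun n : ℕ => ((n : ℝ)⁻¹)) atTop (𝓝 0) :=
      tendsto_inv_atTop_zero.comp tendsto_natCast_atTop_atTop
    have := hcont.tendsto.comp h0
    rwa [Real.rpow_zero] at this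
  · have hc := not_isReal_iff_isComplex.mp hw
    simp only [root, dif_neg hw, InfiniteAdeleRing.one_apply']
    have h1 : (1 : w.Completion) = (isometryEquivComplexOfIsComplex hc).symm 1 := by
      apply (isometryEquivComplexOfIsComplex hc).injective
      rw [IsometryEquiv.apply_symm_apply]
      exact map_one (ringEquivComplexOfIsComplex hc)
    rw [h1]
    refine ((isometryEquivComplexOfIsComplex hc).symm.continuous.tendsto _).comp ?_
    set L : ℂ := Complex.log (extensionEmbedding w ((x : InfiniteAdeleRing K) w)) with hL
    have h0 : Tendsto (fun n : ℕ => L / n) atTop (𝓝 0) := by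
      rw [tendsto_zero_iff_norm_tendsto_zero]
      have : (fun n : ℕ => ‖L / n‖) = fun n : ℕ => ‖L‖ * (n : ℝ)⁻¹ := by
        funext n
        rw [norm_div, Complex.norm_natCast, div_eq_mul_inv]
      rw [this, ← mul_zero ‖L‖]
      exact tendsto_const_nhds.mul (tendsto_inv_atTop_zero.comp tendsto_natCast_atTop_atTop)
    have := (Complex.continuous_exp.tendsto 0).comp h0
    rwa [Complex.exp_zero] at this

/-- **Totally positive infinite ideles have roots of all orders tending to `1`**: for `x`
totally positive there are `y_n ∈ (K ⊗ ℝ)ˣ` (`n ≥ 1`) with `y_nⁿ = x` and `y_n → 1`.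
Ref: Neukirch, *Algebraic Number Theory*, Ch. VII §6, proof of (6.9) (positive reals and
nonzero complex numbers are `n`-th powers). [folklore] -/
theorem exists_pow_eq_tendsto_one (x : (InfiniteAdeleRing K)ˣ) (hx : IsTotallyPositive x) :
    ∃ y : ℕ → (InfiniteAdeleRing K)ˣ, (∀ n, 0 < n → y n ^ n = x) ∧ Tendsto y atTop (𝓝 1) := by
  classical
  -- the roots are units
  have hunit : ∀ n, 0 < n → IsUnit (root n x) := fun n hn =>
    (isUnit_pow_iff hn.ne').mp (by rw [root_pow hn hx]; exact x.isUnit)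
  set y : ℕ → (InfiniteAdeleRing K)ˣ := fun n => if hn : 0 < n then (hunit n hn).unit else 1 with hy
  have hyval : ∀ n, 0 < n → ((y n : (InfiniteAdeleRing K)ˣ) : InfiniteAdeleRing K) = root n x := by
    intro n hn; simp only [hy, dif_pos hn, IsUnit.unit_spec]
  refine ⟨y, fun n hn => Units.ext ?_, ?_⟩
  · rw [Units.val_pow_eq_pow_val, hyval n hn, root_pow hn hx]
  · -- `y_n → 1` in the units: values and inverses converge coordinatewise
    have hval : Tendsto (fun n => ((y n : (InfiniteAdeleRing K)ˣ) : InfiniteAdeleRing K)) atTop (𝓝 1) := by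
      refine (tendsto_root x hx).congr' ?_
      filter_upwards [eventually_gt_atTop 0] with n hn
      exact (hyval n hn).symm
    refine HeckeCharacter.tendsto_units_of_val_of_inv (by simpa using hval) ?_
    rw [inv_one, Units.val_one]
    -- inverses: coordinatewise `(y_n)_w⁻¹ → 1`
    have hval' := tendsto_pi_nhds.mp hval
    refine tendsto_pi_nhds.mpr fun w => ?_
    have hinv : ∀ n, (((y n)⁻¹ : (InfiniteAdeleRing K)ˣ) : InfiniteAdeleRing K) w =
        (((y n : (InfiniteAdeleRing K)ˣ) : InfiniteAdeleRing K) w)⁻¹ := by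
      intro n
      have h1 : (((y n)⁻¹ : (InfiniteAdeleRing K)ˣ) : InfiniteAdeleRing K) w *
          ((y n : (InfiniteAdeleRing K)ˣ) : InfiniteAdeleRing K) w = 1 := by
        rw [← InfiniteAdeleRing.mul_apply', ← Units.val_mul, inv_mul_cancel, Units.val_one]; rfl
      exact eq_inv_of_mul_eq_one_left h1
    simp only [hinv, InfiniteAdeleRing.one_apply']
    have := (hval' w).inv₀ (by rw [InfiniteAdeleRing.one_apply']; exact one_ne_zero)
    rwa [InfiniteAdeleRing.one_apply', inv_one] at this

end InfiniteIdele

/-! ### §2. The infinity type of an algebraic Hecke character on `(K ⊗ ℝ)ˣ_{>0}` -/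

variable [NumberField K]

namespace HeckeCharacter

/-- The **archimedean factor of type `(p, q)`**:
`A_{p,q}(x) = ∏_{w ∣ ∞} ι_w(x_w)^{-p_w} \overline{ι_w(x_w)}^{-q_w}` for `x ∈ (K ⊗ ℝ)ˣ`, as a monoid
homomorphism `(K ⊗ ℝ)ˣ →* ℂ` (the right-hand side of `HeckeCharacter.IsAlgebraic`).
Ref: Weil 1956, §1; Serre 1968, Ch. II §2.4. [cite: SerreAbelianLadic1968, Ch. II §2.4] -/
def archFactor (p q : InfinitePlace K → ℤ) : (InfiniteAdeleRing K)ˣ →* ℂ where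
  toFun x := ∏ w : InfinitePlace K,
    extensionEmbedding w ((x : InfiniteAdeleRing K) w) ^ (-p w) *
      conj (extensionEmbedding w ((x : InfiniteAdeleRing K) w)) ^ (-q w)
  map_one' := by simp
  map_mul' x y := by
    rw [← Finset.prod_mul_distrib]
    refine Finset.prod_congr rfl fun w _ => ?_
    rw [Units.val_mul, InfiniteAdeleRing.mul_apply', map_mul, map_mul, mul_zpow, mul_zpow]
    ring

/-- Unfolding lemma for `archFactor`. [folklore] -/
theorem archFactor_apply (p q : InfinitePlace K → ℤ) (x : (InfiniteAdeleRing K)ˣ) :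
    archFactor p q x = ∏ w : InfinitePlace K,
      extensionEmbedding w ((x : InfiniteAdeleRing K) w) ^ (-p w) *
        conj (extensionEmbedding w ((x : InfiniteAdeleRing K) w)) ^ (-q w) :=
  rfl

/-- `χ` **has infinity type `(p, q)`**: on some neighbourhood of `1` in `(K ⊗ ℝ)ˣ`,
`χ((x, 1)) = A_{p,q}(x)`; so `χ.IsAlgebraic ↔ ∃ p q, χ.HasInfinityType p q`
(`isAlgebraic_iff_exists_hasInfinityType`).  Ref: Weil 1956, §1 (type `A₀`); Serre 1968,
Ch. II §2.4. [cite: SerreAbelianLadic1968, Ch. II §2.4] -/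
def HasInfinityType (χ : HeckeCharacter K) (p q : InfinitePlace K → ℤ) : Prop :=
  ∃ U ∈ 𝓝 (1 : (InfiniteAdeleRing K)ˣ), ∀ x ∈ U, (χ (infiniteIdeles K x) : ℂ) = archFactor p q x

/-- `IsAlgebraic` is the existence of an infinity type (definitional). [folklore] -/
theorem isAlgebraic_iff_exists_hasInfinityType (χ : HeckeCharacter K) :
    χ.IsAlgebraic ↔ ∃ p q : InfinitePlace K → ℤ, χ.HasInfinityType p q :=
  Iff.rfl

/-- **The infinity type governs `χ` on all totally positive infinite ideles.**  If `χ` has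
infinity type `(p, q)` then `χ((x, 1)) = ∏_w ι_w(x_w)^{-p_w} \overline{ι_w(x_w)}^{-q_w}` for every
totally positive `x ∈ (K ⊗ ℝ)ˣ` (roots `y_n → 1` of `x`, `InfiniteIdele.exists_pow_eq_tendsto_one`,
eventually lie in the neighbourhood of the definition, and both sides are multiplicative).
Ref: Weil 1956, §1; Neukirch, *Algebraic Number Theory*, Ch. VII §6 (6.7)–(6.9).
[cite: Weil1956, §1] [cite: NeukirchANT1999, Ch. VII §6 Prop. (6.9)] -/
theorem HasInfinityType.apply_infiniteIdeles_eq {χ : HeckeCharacter K} {p q : InfinitePlace K → ℤ}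
    (h : χ.HasInfinityType p q) {x : (InfiniteAdeleRing K)ˣ} (hx : InfiniteIdele.IsTotallyPositive x) :
    (χ (infiniteIdeles K x) : ℂ) = archFactor p q x := by
  obtain ⟨U, hU, hχ⟩ := h
  obtain ⟨y, hyx, hy⟩ := InfiniteIdele.exists_pow_eq_tendsto_one x hx
  have hev : ∀ᶠ n in atTop, y n ∈ U ∧ 0 < n := (hy.eventually_mem hU).and (eventually_gt_atTop 0)
  obtain ⟨n, hnU, hn⟩ := hev.exists
  rw [← hyx n hn, map_pow, map_pow, Units.val_pow_eq_pow_val, hχ _ hnU, map_pow]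

omit [NumberField K] in
/-- A totally positive `k ∈ Kˣ` (positive under every real embedding) has totally positive
infinite part `(k)_∞`. [folklore] -/
theorem _root_.Literature.NumberTheory.GaloisRepresentations.InfiniteIdele.isTotallyPositive_globalToInfiniteUnits
    {k : Kˣ} (hpos : ∀ φ : K →+* ℝ, 0 < φ k) :
    InfiniteIdele.IsTotallyPositive (globalToInfiniteUnits K k) := by
  intro w hw
  have h1 : extensionEmbeddingOfIsReal hw ((globalToInfiniteUnits K k : InfiniteAdeleRing K) w) =
      embedding_of_isReal hw (k : K) := by
    rw [val_globalToInfiniteUnits, InfiniteAdeleRing.algebraMap_apply]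
    exact extensionEmbeddingOfIsReal_coe hw (WithAbs.toAbs w.1 (k : K))
  rw [h1]
  exact hpos _

/-- The archimedean factor of a principal infinite idele:
`A_{p,q}((k)_∞) = ∏_w σ_w(k)^{-p_w} \overline{σ_w(k)}^{-q_w}`, `σ_w` the embedding of `w`. [folklore] -/
theorem archFactor_globalToInfiniteUnits (p q : InfinitePlace K → ℤ) (k : Kˣ) :
    archFactor p q (globalToInfiniteUnits K k) =
      ∏ w : InfinitePlace K, w.embedding (k : K) ^ (-p w) * conj (w.embedding (k : K)) ^ (-q w) := by
  rw [archFactor_apply]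
  refine Finset.prod_congr rfl fun w _ => ?_
  have h1 : extensionEmbedding w ((globalToInfiniteUnits K k : InfiniteAdeleRing K) w) = w.embedding (k : K) := by
    rw [val_globalToInfiniteUnits, InfiniteAdeleRing.algebraMap_apply]
    exact extensionEmbedding_coe w (WithAbs.toAbs w.1 (k : K))
  rw [h1]

/-- **The infinity type on totally positive principal ideles**: for `k ∈ Kˣ` positive under every
real embedding, `χ((k)_∞) = ∏_w σ_w(k)^{-p_w} \overline{σ_w(k)}^{-q_w}`.
Ref: Neukirch, *Algebraic Number Theory*, Ch. VII §6 (6.7)–(6.9) (`χ_∞((a))` for `a ∈ K^*`).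
[cite: NeukirchANT1999, Ch. VII §6 Prop. (6.9)] -/
theorem HasInfinityType.apply_globalToInfiniteUnits_eq {χ : HeckeCharacter K} {p q : InfinitePlace K → ℤ}
    (h : χ.HasInfinityType p q) {k : Kˣ} (hpos : ∀ φ : K →+* ℝ, 0 < φ k) :
    (χ (infiniteIdeles K (globalToInfiniteUnits K k)) : ℂ) =
      ∏ w : InfinitePlace K, w.embedding (k : K) ^ (-p w) * conj (w.embedding (k : K)) ^ (-q w) := by
  rw [h.apply_infiniteIdeles_eq (InfiniteIdele.isTotallyPositive_globalToInfiniteUnits hpos),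
    archFactor_globalToInfiniteUnits]

/-! ### §3. Every Hecke character has a module of definition supported on its ramified places -/

/-- A neighbourhood of `1` in the ideles on which `χ` stays within `1/2` of `1`. [folklore] -/
theorem preimage_ball_mem_nhds (χ : HeckeCharacter K) :
    {x : ideleGroup K | ‖(χ x : ℂ) - 1‖ < 1 / 2} ∈ 𝓝 (1 : ideleGroup K) := by
  have hc : Continuous fun x : ideleGroup K => ‖(χ x : ℂ) - 1‖ := by fun_prop
  exact (isOpen_lt hc continuous_const).mem_nhds (by simp)

/-- Powers of an idele congruent to `1` stay congruent to `1` (ultrametric inequality). [folklore] -/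
theorem valued_pow_sub_one_le {v : HeightOneSpectrum (𝓞 K)} {a : v.adicCompletion K} {r : WithZero (Multiplicative ℤ)}
    (hu : Valued.v a = 1) (h : Valued.v (a - 1) ≤ r) (n : ℕ) : Valued.v (a ^ n - 1) ≤ r := by
  induction n with
  | zero => rw [pow_zero, sub_self, map_zero]; exact zero_le
  | succ n ih =>
    have : a ^ (n + 1) - 1 = a * (a ^ n - 1) + (a - 1) := by ring
    rw [this]
    refine (Valuation.map_add _ _ _).trans (max_le ?_ h)
    rw [map_mul, hu, one_mul]
    exact ih

/-- **Every Hecke character has a module of definition**: there are a finite set `T` of finite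
places and exponents `e` with `HeckeCharacter.IsModulus χ T e` — `χ` kills every idele `x` with
`x_∞ = 1`, all `x_v ∈ 𝒪_vˣ` and `x_v ≡ 1 mod 𝔭_v^{e_v}` for `v ∈ T`.  (The kernel of `χ` contains a
basic congruence subgroup: the congruence subgroups form a neighbourhood basis of the compact group
`∏_v 𝒪_vˣ`, and a subgroup of `ℂˣ` inside `{|z - 1| < 1/2}` is trivial.)
Ref: Neukirch, *Algebraic Number Theory*, Ch. VII §6, paragraph after Def. (6.11); Tate,
Cassels–Fröhlich Ch. XV, Lemma 3.2.1. [cite: NeukirchANT1999, Ch. VII §6 (6.11)] -/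
theorem exists_isModulus (χ : HeckeCharacter K) :
    ∃ (T : Finset (HeightOneSpectrum (𝓞 K))) (e : HeightOneSpectrum (𝓞 K) → ℕ), IsModulus χ T e := by
  obtain ⟨T, hT, e, hTe⟩ := ideleGroup_exists_congruenceSubgroup_subset χ.preimage_ball_mem_nhds
  refine ⟨hT.toFinset, e, fun x hx1 hxu hxc => ?_⟩
  -- all powers of `x` satisfy the same congruences, so `χ(x)^n` stays near `1`
  rw [← Units.val_eq_one]
  refine eq_one_of_norm_pow_sub_one_le (c := 1 / 2) (by norm_num) fun n => le_of_lt ?_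
  have h1 : ((x ^ n : ideleGroup K) : AdeleRing (𝓞 K) K).1 = ((x : AdeleRing (𝓞 K) K).1) ^ n := rfl
  have h2 : ∀ v, ((x ^ n : ideleGroup K) : AdeleRing (𝓞 K) K).2 v = ((x : AdeleRing (𝓞 K) K).2 v) ^ n :=
    fun v => rfl
  have hmem := hTe (x ^ n) ?_ (fun v => ?_) (fun v hv => ?_)
  · simp only [Set.mem_setOf_eq, map_pow, Units.val_pow_eq_pow_val] at hmem
    exact hmem
  · rw [h1, hx1, one_pow]
  · rw [h2, map_pow, hxu, one_pow]
  · rw [h2]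
    exact valued_pow_sub_one_le (hxu v) (hxc v (hT.mem_toFinset.mpr hv)) n

/-- **Every Hecke character has a module of definition supported exactly on its ramified places**
(`finite_ramifiedPlaces_holds`; unramified places of a module of definition may be dropped,
`IsModulus.of_isUnramifiedAt`).  Ref: Neukirch, *Algebraic Number Theory*, Ch. VII §6, after
Def. (6.11), with (6.12) (`χ_𝔭(U_𝔭) = 1` for `𝔭 ∤ 𝔪`). [cite: NeukirchANT1999, Ch. VII §6 (6.11)–(6.12)] -/
theorem exists_isModulus_of_ramified (χ : HeckeCharacter K) :
    ∃ e : HeightOneSpectrum (𝓞 K) → ℕ,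
      IsModulus χ (finite_ramifiedPlaces_holds χ).toFinset e := by
  obtain ⟨T, e, hmod⟩ := χ.exists_isModulus
  refine ⟨e, hmod.of_isUnramifiedAt fun v _ hv => ?_⟩
  by_contra h
  exact hv ((finite_ramifiedPlaces_holds χ).mem_toFinset.mpr h)


/-! ### §4. The Größencharakter of an algebraic Hecke character on the ray modulo `𝔪` -/

omit [NumberField K] in
/-- `0 < φ(b) φ(c)` means `φ(b/c) > 0`. [folklore] -/
theorem pos_div_of_mul_pos {b c : K} (hc : c ≠ 0) (φ : K →+* ℝ) (h : 0 < φ b * φ c) : 0 < φ (b / c) := by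
  have hφc : φ c ≠ 0 := (map_ne_zero φ).2 hc
  rw [map_div₀]
  rcases lt_or_gt_of_ne hφc with h' | h'
  · exact div_pos_of_neg_of_neg (by nlinarith) h'
  · exact div_pos (by nlinarith) h'

/-- **The Größencharakter of an algebraic Hecke character on the ray.**  Let `χ` have module of
definition `(T, e)` (`𝔪 = ∏_{v ∈ T} 𝔭_v^{e_v+1}`) and infinity type `(p, q)`, and let
`χ̃(𝔞) = ∏_𝔭 χ(ϖ_𝔭)^{v_𝔭(𝔞)}` be its ideal-theoretic character (`LFunctions.idealPow` of
`v ↦ χ(ϖ_v)`).  For nonzero integers `b, c` with `c` prime to `𝔪`, `b ≡ c mod 𝔪` and `b/c` totally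
positive, `χ̃((b)) = χ̃((c)) · ∏_w σ_w(b/c)^{p_w} \overline{σ_w(b/c)}^{q_w}`: i.e. on the ray `P^𝔪`,
`χ̃((a)) = ∏_w σ_w(a)^{p_w} \overline{σ_w(a)}^{q_w}` — `χ̃` is a Größencharakter `mod 𝔪` of infinity
type `(p, q)`.  Proof: Neukirch's decomposition of the principal ideles `b`, `c` (VII (6.13),
`map_principalIdele_eq`): the local factors at `T` agree (`b/c ∈ U_𝔭^{(e_𝔭+1)}`), those off `T` are
`χ(ϖ_𝔭)^{v_𝔭}`, and the infinite parts differ by `χ((b/c)_∞) = A_{p,q}((b/c)_∞)`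
(`HasInfinityType.apply_globalToInfiniteUnits_eq`).  Ref: Neukirch, *Algebraic Number Theory*,
Ch. VII §6 Def. (6.7), Prop. (6.13), Cor. (6.14); Weil 1956 §1.
[cite: NeukirchANT1999, Ch. VII §6 Prop. (6.13) and Cor. (6.14)] [cite: Weil1956, §1] -/
theorem HasInfinityType.idealPow_span_eq {χ : HeckeCharacter K} {p q : InfinitePlace K → ℤ}
    (hinf : χ.HasInfinityType p q) {T : Finset (HeightOneSpectrum (𝓞 K))}
    {e : HeightOneSpectrum (𝓞 K) → ℕ} (hmod : IsModulus χ T e) {b c : 𝓞 K} (hb : b ≠ 0) (hc : c ≠ 0)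
    (hcop : IsCoprime (Ideal.span {c}) (modulusIdeal T e)) (hbc : b - c ∈ modulusIdeal T e)
    (hpos : ∀ φ : K →+* ℝ, 0 < φ b * φ c) :
    LFunctions.idealPow K (fun v => χ.valueAtUniformizer v) (Ideal.span {b}) =
      LFunctions.idealPow K (fun v => χ.valueAtUniformizer v) (Ideal.span {c}) *
        ∏ w : InfinitePlace K, w.embedding ((b : K) / c) ^ (p w) * conj (w.embedding ((b : K) / c)) ^ (q w) := by
  classical
  -- notation and basic facts (as in `isRayClassCharacter_of_isModulus`)
  have hb' : (b : K) ≠ 0 := fun h => hb (by exact_mod_cast h)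
  have hc' : (c : K) ≠ 0 := fun h => hc (by exact_mod_cast h)
  set bu : Kˣ := Units.mk0 (b : K) hb' with hbu
  set cu : Kˣ := Units.mk0 (c : K) hc' with hcu
  have hbcop : IsCoprime (Ideal.span {b}) (modulusIdeal T e) := LFunctions.isCoprime_span_of_sub_mem hcop hbc
  have hcT : ∀ v ∈ T, c ∉ v.asIdeal := fun v hv hcv =>
    (LFunctions.isCoprime_iff_forall_not_le (modulusIdeal_ne_bot T e)).mp hcop v (modulusIdeal_le_iff.mpr hv)
      ((Ideal.span_singleton_le_iff_mem _).mpr hcv)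
  have hbT : ∀ v ∈ T, b ∉ v.asIdeal := fun v hv hbv =>
    (LFunctions.isCoprime_iff_forall_not_le (modulusIdeal_ne_bot T e)).mp hbcop v (modulusIdeal_le_iff.mpr hv)
      ((Ideal.span_singleton_le_iff_mem _).mpr hbv)
  have hvalb : ∀ v ∈ T, v.valuation K (b : K) = 1 := fun v hv =>
    (HeightOneSpectrum.valuation_eq_one_iff_notMem (K := K) v).mpr (hbT v hv)
  have hvalc : ∀ v ∈ T, v.valuation K (c : K) = 1 := fun v hv =>
    (HeightOneSpectrum.valuation_eq_one_iff_notMem (K := K) v).mpr (hcT v hv)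
  -- the finite set `S ⊇ T` outside which `b` and `c` are units
  set S : Finset (HeightOneSpectrum (𝓞 K)) :=
    T ∪ (finite_setOf_valuation_coe_ne_one (K := K) hb).toFinset ∪
      (finite_setOf_valuation_coe_ne_one (K := K) hc).toFinset with hSdef
  have hTS : T ⊆ S := Finset.subset_union_left.trans Finset.subset_union_left
  have hSb : ∀ v ∉ S, v.valuation K (b : K) = 1 := fun v hv => by
    by_contra h
    exact hv (Finset.mem_union_left _ (Finset.mem_union_right _ ((Set.Finite.mem_toFinset _).mpr h)))
  have hSc : ∀ v ∉ S, v.valuation K (c : K) = 1 := fun v hv => by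
    by_contra h
    exact hv (Finset.mem_union_right _ ((Set.Finite.mem_toFinset _).mpr h))
  -- Neukirch's decomposition for `b` and `c`
  have hB := map_principalIdele_eq hmod bu hTS hSb
  have hC := map_principalIdele_eq hmod cu hTS hSc
  -- the infinite parts differ by the archimedean factor of `b/c`
  set A : ℂ := ∏ w : InfinitePlace K, w.embedding ((b : K) / c) ^ (-p w) * conj (w.embedding ((b : K) / c)) ^ (-q w)
    with hA
  have hbcval : ((bu * cu⁻¹ : Kˣ) : K) = (b : K) / c := by
    rw [Units.val_mul, Units.val_inv_eq_inv_val, hbu, hcu, Units.val_mk0, Units.val_mk0, div_eq_mul_inv]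
  have hposq : ∀ φ : K →+* ℝ, 0 < φ ((bu * cu⁻¹ : Kˣ) : K) := fun φ => by
    rw [hbcval]; exact pos_div_of_mul_pos hc' φ (hpos φ)
  have hinfq : (χ (infiniteIdeles K (globalToInfiniteUnits K (bu * cu⁻¹))) : ℂ) = A := by
    rw [hinf.apply_globalToInfiniteUnits_eq hposq, hA]
    simp only [hbcval]
  have hA0 : A ≠ 0 := by rw [← hinfq]; exact Units.ne_zero _
  have hIb : χ (infiniteIdeles K (globalToInfiniteUnits K bu)) =
      χ (infiniteIdeles K (globalToInfiniteUnits K cu)) * χ (infiniteIdeles K (globalToInfiniteUnits K (bu * cu⁻¹))) := by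
    rw [map_mul, map_inv, map_mul, map_inv, map_mul, map_inv, mul_comm, inv_mul_cancel_right]
  -- the parts at `T` agree
  have hTpart : ∏ v ∈ T, χ (localUnits v (globalToLocalUnits v bu)) =
      ∏ v ∈ T, χ (localUnits v (globalToLocalUnits v cu)) := by
    have h1 := map_prod_localUnits_eq_one_of_isModulus hmod
      (fun v => globalToLocalUnits v bu * (globalToLocalUnits v cu)⁻¹) (fun v hv => ?_) (fun v hv => ?_)
    · simp only [map_mul, map_inv, Finset.prod_mul_distrib, Finset.prod_inv_distrib,
        mul_inv_eq_one, map_prod] at h1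
      exact h1
    · rw [Units.val_mul, Units.val_inv_eq_inv_val, map_mul, map_inv₀, val_globalToLocalUnits,
        val_globalToLocalUnits, valued_algebraMap_adicCompletion, valued_algebraMap_adicCompletion,
        hbu, hcu, Units.val_mk0, Units.val_mk0, hvalb v hv, hvalc v hv, inv_one, mul_one]
    · have hcv : Valued.v (algebraMap K (v.adicCompletion K) (c : K)) = 1 := by
        rw [valued_algebraMap_adicCompletion]; exact hvalc v hv
      have hc0 : algebraMap K (v.adicCompletion K) (c : K) ≠ 0 := (map_ne_zero _).2 hc'
      have heq : ((globalToLocalUnits v bu * (globalToLocalUnits v cu)⁻¹ : (v.adicCompletion K)ˣ) :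
          v.adicCompletion K) - 1 =
          (algebraMap K (v.adicCompletion K) (b : K) - algebraMap K (v.adicCompletion K) (c : K)) *
            (algebraMap K (v.adicCompletion K) (c : K))⁻¹ := by
        rw [Units.val_mul, Units.val_inv_eq_inv_val, val_globalToLocalUnits, val_globalToLocalUnits,
          hbu, hcu, Units.val_mk0, Units.val_mk0, sub_mul, mul_inv_cancel₀ hc0]
      have hcast : (b : K) - (c : K) = algebraMap (𝓞 K) K (b - c) := by
        rw [map_sub]
      rw [heq, map_mul, map_inv₀, hcv, inv_one, mul_one, ← map_sub, valued_algebraMap_adicCompletion,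
        hcast, HeightOneSpectrum.valuation_of_algebraMap]
      have hmem : b - c ∈ v.asIdeal ^ (e v + 1) :=
        Ideal.le_of_dvd (pow_dvd_modulusIdeal e hv) hbc
      calc v.intValuation (b - c) ≤ WithZero.exp (-((e v + 1 : ℕ) : ℤ)) :=
            (HeightOneSpectrum.intValuation_le_pow_iff_mem v (b - c) (e v + 1)).mpr hmem
        _ ≤ WithZero.exp (-(e v : ℤ)) := WithZero.exp_le_exp.mpr (by push_cast; linarith)
  -- translate the local values off `T` into powers of `χ(ϖ_v)`
  have hval : ∀ {d : 𝓞 K} (hd : d ≠ 0) (du : Kˣ) (hdu : (du : K) = d), ∀ v ∈ S \ T,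
      (χ (localUnits v (globalToLocalUnits v du)) : ℂ) =
        χ.valueAtUniformizer v ^ (Associates.mk v.asIdeal).count
          (Associates.mk (Ideal.span {d} : Ideal (𝓞 K))).factors := by
    intro d hd du hdu v hv
    have hvT : v ∉ T := (Finset.mem_sdiff.mp hv).2
    rw [(isUnramifiedAt_of_isModulus' hmod hvT).coe_map_localUnits_eq_zpow (globalToLocalUnits v du)
      (m := ((Associates.mk v.asIdeal).count (Associates.mk (Ideal.span {d} : Ideal (𝓞 K))).factors : ℤ))
      (by rw [val_globalToLocalUnits, hdu]; exact valued_coe_ringOfIntegers v hd), zpow_natCast]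
  have hprod : ∀ {d : 𝓞 K} (hd : d ≠ 0) (du : Kˣ) (hdu : (du : K) = d)
      (hdT : ∀ v ∈ T, d ∉ v.asIdeal) (hdS : ∀ v ∉ S, v.valuation K (d : K) = 1),
      LFunctions.idealPow K (fun v => χ.valueAtUniformizer v) (Ideal.span {d}) =
        ((∏ v ∈ S \ T, χ (localUnits v (globalToLocalUnits v du)) : ℂˣ) : ℂ) := by
    intro d hd du hdu hdT hdS
    rw [Units.coe_prod, LFunctions.idealPow, finprod_eq_prod_of_mulSupport_subset _ (s := S \ T) ?_]
    · exact Finset.prod_congr rfl fun v hv => (hval hd du hdu v hv).symm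
    · intro v hv
      rw [Function.mem_mulSupport] at hv
      have hcnt : (Associates.mk v.asIdeal).count
          (Associates.mk (Ideal.span {d} : Ideal (𝓞 K))).factors ≠ 0 := fun h0 => hv (by rw [h0, pow_zero])
      have hdvd : v.asIdeal ∣ Ideal.span {d} :=
        (Associates.count_ne_zero_iff_dvd ((Submodule.ne_bot_iff _).mpr
          ⟨d, Ideal.mem_span_singleton_self d, hd⟩) v.irreducible).mp hcnt
      have hdv : d ∈ v.asIdeal := Ideal.dvd_span_singleton.mp hdvd
      rw [Finset.coe_sdiff, Set.mem_sdiff, Finset.mem_coe, Finset.mem_coe]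
      refine ⟨?_, fun hvT => hdT v hvT hdv⟩
      by_contra hvS
      have := hdS v hvS
      rw [HeightOneSpectrum.valuation_eq_one_iff_notMem (K := K) v] at this
      exact this hdv
  -- the algebra, in `ℂ`
  rw [← Finset.prod_sdiff hTS, hTpart, hIb] at hB
  rw [← Finset.prod_sdiff hTS] at hC
  have h1 := congrArg Units.val hB
  have h2 := congrArg Units.val hC
  simp only [Units.val_mul, Units.val_one] at h1 h2
  rw [hinfq] at h1
  set Ic : ℂ := (χ (infiniteIdeles K (globalToInfiniteUnits K cu)) : ℂ) with hIc
  set Pb : ℂ := ((∏ v ∈ S \ T, χ (localUnits v (globalToLocalUnits v bu)) : ℂˣ) : ℂ) with hPb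
  set Pc : ℂ := ((∏ v ∈ S \ T, χ (localUnits v (globalToLocalUnits v cu)) : ℂˣ) : ℂ) with hPc
  set PT : ℂ := ((∏ v ∈ T, χ (localUnits v (globalToLocalUnits v cu)) : ℂˣ) : ℂ) with hPT
  have hIc0 : Ic ≠ 0 := Units.ne_zero _
  have hPT0 : PT ≠ 0 := Units.ne_zero _
  -- `h1 : Ic * A * (Pb * PT) = 1`, `h2 : Ic * (Pc * PT) = 1`
  have key : (Pb * A - Pc) * (Ic * PT) = 0 := by linear_combination h1 - h2
  have hPbA : Pb * A = Pc := by
    have := mul_eq_zero.mp key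
    rcases this with h | h
    · exact sub_eq_zero.mp h
    · exact absurd h (mul_ne_zero hIc0 hPT0)
  have hinvA : A⁻¹ = ∏ w : InfinitePlace K, w.embedding ((b : K) / c) ^ (p w) * conj (w.embedding ((b : K) / c)) ^ (q w) := by
    rw [hA, ← Finset.prod_inv_distrib]
    refine Finset.prod_congr rfl fun w _ => ?_
    rw [mul_inv, zpow_neg, zpow_neg, inv_inv, inv_inv]
  rw [hprod hb bu rfl hbT hSb, hprod hc cu rfl hcT hSc, ← hinvA, ← hPb, ← hPc, ← hPbA,
    mul_inv_cancel_right₀ hA0]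


/-- The ideal-theoretic character of nonzero local values is nonzero. [folklore] -/
theorem idealPow_ne_zero {ψ : HeightOneSpectrum (𝓞 K) → ℂ} (hψ : ∀ v, ψ v ≠ 0) (I : Ideal (𝓞 K)) :
    LFunctions.idealPow K ψ I ≠ 0 := by
  unfold LFunctions.idealPow
  exact finprod_induction (fun z : ℂ => z ≠ 0) one_ne_zero (fun _ _ => mul_ne_zero) fun v => pow_ne_zero _ (hψ v)

/-- `χ(ϖ_v) ≠ 0`. [folklore] -/
theorem valueAtUniformizer_ne_zero' (χ : HeckeCharacter K) (v : HeightOneSpectrum (𝓞 K)) :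
    χ.valueAtUniformizer v ≠ 0 :=
  Units.ne_zero _

end HeckeCharacter

/-! ### §5. `ℓ`-adic congruences on the ray modulo `ℓ^N` -/

section OneUnits

variable (L : Type*) [NormedField L] [IsUltrametricDist L]

/-- **The one-units of level `r`** (`0 ≤ r < 1`) of an ultrametric normed field:
`U_r = {u : ‖u - 1‖ ≤ r}`, a subgroup of `Lˣ`.  Ref: Serre, *Local Fields*, Ch. IV §2 (the
filtration `U^{(n)}`). [folklore] -/
def oneUnitsLE (r : ℝ) (hr0 : 0 ≤ r) (hr : r < 1) : Subgroup Lˣ where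
  carrier := {u | ‖(u : L) - 1‖ ≤ r}
  one_mem' := by simp [hr0]
  mul_mem' := by
    intro u v hu hv
    simp only [Set.mem_setOf_eq, Units.val_mul] at hu hv ⊢
    have hu1 : ‖(u : L)‖ = 1 := by
      have hne : ‖(u : L) - 1‖ ≠ ‖(1 : L)‖ := by rw [norm_one]; exact (hu.trans_lt hr).ne
      have h := IsUltrametricDist.norm_add_eq_max_of_norm_ne_norm hne
      rw [sub_add_cancel, norm_one] at h
      rw [h, max_eq_right (hu.trans_lt hr).le]
    have : (u : L) * v - 1 = u * (v - 1) + (u - 1) := by ring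
    rw [this]
    refine (IsUltrametricDist.norm_add_le_max _ _).trans (max_le ?_ hu)
    rw [norm_mul, hu1, one_mul]
    exact hv
  inv_mem' := by
    intro u hu
    simp only [Set.mem_setOf_eq, Units.val_inv_eq_inv_val] at hu ⊢
    have hu1 : ‖(u : L)‖ = 1 := by
      have hne : ‖(u : L) - 1‖ ≠ ‖(1 : L)‖ := by rw [norm_one]; exact (hu.trans_lt hr).ne
      have h := IsUltrametricDist.norm_add_eq_max_of_norm_ne_norm hne
      rw [sub_add_cancel, norm_one] at h
      rw [h, max_eq_right (hu.trans_lt hr).le]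
    have hu0 : (u : L) ≠ 0 := u.ne_zero
    have : (u : L)⁻¹ - 1 = (u : L)⁻¹ * (1 - u) := by rw [mul_sub, mul_one, inv_mul_cancel₀ hu0]
    rw [this, norm_mul, norm_inv, hu1, inv_one, one_mul, norm_sub_rev]
    exact hu

variable {L}

/-- Membership in `oneUnitsLE`. [folklore] -/
@[simp] theorem mem_oneUnitsLE_iff {r : ℝ} {hr0 : 0 ≤ r} {hr : r < 1} {u : Lˣ} :
    u ∈ oneUnitsLE L r hr0 hr ↔ ‖(u : L) - 1‖ ≤ r :=
  Iff.rfl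

end OneUnits

section Embeddings

variable {ℓ : ℕ} [Fact ℓ.Prime]

omit [NumberField K] in
/-- Algebraic integers have `ℓ`-adic norm at most one under every embedding `K → ℚ̄_ℓ`. [folklore] -/
theorem norm_embedding_coe_le_one (τ : K →+* PadicAlgCl ℓ) (d : 𝓞 K) : ‖τ (d : K)‖ ≤ 1 :=
  Automorphic.PadicAlgCl.norm_le_one_of_isIntegral ℓ ((RingOfIntegers.isIntegral_coe d).map τ.toIntAlgHom)

omit [NumberField K] in
/-- An integer prime to `ℓ` is an `ℓ`-adic unit under every embedding `K → ℚ̄_ℓ`. [folklore] -/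
theorem norm_embedding_coe_eq_one_of_isCoprime (τ : K →+* PadicAlgCl ℓ) {c : 𝓞 K}
    (hcop : IsCoprime (Ideal.span {c}) (Ideal.span {((ℓ : ℕ) : 𝓞 K)})) : ‖τ (c : K)‖ = 1 := by
  rw [Ideal.isCoprime_span_singleton_iff] at hcop
  obtain ⟨r, s, hrs⟩ := hcop
  have h1 : τ (r : K) * τ (c : K) = 1 - τ (s : K) * (ℓ : PadicAlgCl ℓ) := by
    have := congrArg (fun x : 𝓞 K => τ (x : K)) hrs
    simp only [map_add, map_mul, map_natCast, map_one] at this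
    rw [eq_sub_iff_add_eq]
    simpa only [RingOfIntegers.coe_eq_algebraMap] using this
  have hsmall : ‖τ (s : K) * (ℓ : PadicAlgCl ℓ)‖ < 1 := by
    rw [norm_mul]
    calc ‖τ (s : K)‖ * ‖(ℓ : PadicAlgCl ℓ)‖ ≤ 1 * ‖(ℓ : PadicAlgCl ℓ)‖ :=
          mul_le_mul_of_nonneg_right (norm_embedding_coe_le_one τ s) (norm_nonneg _)
      _ < 1 := by rw [one_mul]; exact Automorphic.PadicAlgCl.norm_natCast_p_lt_one ℓ
  have hprod : ‖τ (r : K) * τ (c : K)‖ = 1 := by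
    have hlt : ‖τ (r : K) * τ (c : K) - 1‖ < 1 := by
      rw [h1, sub_sub_cancel_left, norm_neg]
      exact hsmall
    have hne : ‖τ (r : K) * τ (c : K) - 1‖ ≠ ‖(1 : PadicAlgCl ℓ)‖ := by rw [norm_one]; exact hlt.ne
    have h := IsUltrametricDist.norm_add_eq_max_of_norm_ne_norm hne
    rw [sub_add_cancel, norm_one] at h
    rw [h, max_eq_right hlt.le]
  rw [norm_mul] at hprod
  have hr := norm_embedding_coe_le_one τ r
  have hc := norm_embedding_coe_le_one τ c
  by_contra hne
  have hlt : ‖τ (c : K)‖ < 1 := lt_of_le_of_ne hc hne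
  have : ‖τ (r : K)‖ * ‖τ (c : K)‖ < 1 := by
    calc ‖τ (r : K)‖ * ‖τ (c : K)‖ ≤ 1 * ‖τ (c : K)‖ := mul_le_mul_of_nonneg_right hr (norm_nonneg _)
      _ < 1 := by rw [one_mul]; exact hlt
  exact this.ne hprod

omit [NumberField K] in
/-- **`ℓ`-adic congruence**: for integers `b, c` with `c` prime to `ℓ` and `b ≡ c mod ℓ^N`,
`‖τ(b/c) - 1‖ ≤ ‖ℓ‖^N` under every embedding `τ : K → ℚ̄_ℓ`. [folklore] -/
theorem norm_embedding_div_sub_one_le (τ : K →+* PadicAlgCl ℓ) {N : ℕ} {b c : 𝓞 K} (hc : c ≠ 0)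
    (hcop : IsCoprime (Ideal.span {c}) (Ideal.span {((ℓ : ℕ) : 𝓞 K)}))
    (hbc : b - c ∈ Ideal.span {((ℓ : ℕ) : 𝓞 K) ^ N}) :
    ‖τ ((b : K) / c) - 1‖ ≤ ‖(ℓ : PadicAlgCl ℓ)‖ ^ N := by
  obtain ⟨d, hd⟩ := Ideal.mem_span_singleton'.mp hbc
  have hc' : (c : K) ≠ 0 := fun h => hc (by exact_mod_cast h)
  have hτc : τ (c : K) ≠ 0 := (map_ne_zero τ).mpr hc'
  have hdiff : τ (b : K) - τ (c : K) = τ (d : K) * (ℓ : PadicAlgCl ℓ) ^ N := by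
    have := congrArg (fun x : 𝓞 K => τ (x : K)) hd
    simp only [map_mul, map_pow, map_natCast, map_sub] at this
    simpa only [RingOfIntegers.coe_eq_algebraMap] using this.symm
  have heq : τ ((b : K) / c) - 1 = (τ (b : K) - τ (c : K)) / τ (c : K) := by
    rw [map_div₀, sub_div, div_self hτc]
  rw [heq, hdiff, norm_div, norm_embedding_coe_eq_one_of_isCoprime τ hcop, div_one, norm_mul, norm_pow]
  calc ‖τ (d : K)‖ * ‖(ℓ : PadicAlgCl ℓ)‖ ^ N ≤ 1 * ‖(ℓ : PadicAlgCl ℓ)‖ ^ N :=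
        mul_le_mul_of_nonneg_right (norm_embedding_coe_le_one τ d) (pow_nonneg (norm_nonneg _) _)
    _ = _ := one_mul _

/-- `0 ≤ ‖ℓ‖^N < 1`-type bookkeeping: `‖ℓ‖^N < 1` for `N ≥ 1`. [folklore] -/
theorem norm_natCast_pow_lt_one {N : ℕ} (hN : 0 < N) : ‖(ℓ : PadicAlgCl ℓ)‖ ^ N < 1 :=
  pow_lt_one₀ (norm_nonneg _) (Automorphic.PadicAlgCl.norm_natCast_p_lt_one ℓ) hN.ne'

/-- **`ℓ`-adic congruence for the archimedean ratio.**  For `b, c ∈ 𝓞 K` nonzero with `c` prime to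
`ℓ` and `b ≡ c mod ℓ^N` (`N ≥ 1`), and any field isomorphism `ι : ℚ̄_ℓ ≃+* ℂ`, the `ℓ`-adic number
`ι⁻¹(∏_w σ_w(b/c)^{p_w} \overline{σ_w(b/c)}^{q_w})` is a one-unit of level `‖ℓ‖^N`: each factor is
`τ(b/c)^{±}` for an embedding `τ = ι⁻¹ ∘ σ_w` or `ι⁻¹ ∘ \overline{σ_w}` of `K` into `ℚ̄_ℓ`
(`norm_embedding_div_sub_one_le`), and one-units of a given level form a group (`oneUnitsLE`).
This is the congruence that makes the `λ`-adic avatar of an algebraic Größencharakter a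
character of a ray class group of `ℓ`-power conductor (Weil 1956, §2; Serre 1968, Ch. II §2.7–2.8,
proof of the Proposition of §2.8). [cite: Weil1956, §2] [cite: SerreAbelianLadic1968, Ch. II §2.8] -/
theorem norm_ιsymm_archRatio_sub_one_le (ι : PadicAlgCl ℓ ≃+* ℂ) (p q : InfinitePlace K → ℤ)
    {N : ℕ} (hN : 0 < N) {b c : 𝓞 K} (hb : b ≠ 0) (hc : c ≠ 0)
    (hcop : IsCoprime (Ideal.span {c}) (Ideal.span {((ℓ : ℕ) : 𝓞 K)}))
    (hbc : b - c ∈ Ideal.span {((ℓ : ℕ) : 𝓞 K) ^ N}) :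
    ‖ι.symm (∏ w : InfinitePlace K, w.embedding ((b : K) / c) ^ (p w) * conj (w.embedding ((b : K) / c)) ^ (q w)) - 1‖
      ≤ ‖(ℓ : PadicAlgCl ℓ)‖ ^ N := by
  set r : ℝ := ‖(ℓ : PadicAlgCl ℓ)‖ ^ N with hr
  have hr0 : 0 ≤ r := pow_nonneg (norm_nonneg _) _
  have hr1 : r < 1 := norm_natCast_pow_lt_one hN
  have hbc0 : ((b : K) / c) ≠ 0 := div_ne_zero (fun h => hb (by exact_mod_cast h)) (fun h => hc (by exact_mod_cast h))
  -- the embeddings `τ_w = ι⁻¹ ∘ σ_w` and `τ̄_w = ι⁻¹ ∘ \overline{σ_w}`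
  set τ : InfinitePlace K → (K →+* PadicAlgCl ℓ) := fun w => (ι.symm : ℂ →+* PadicAlgCl ℓ).comp w.embedding
    with hτ
  set τ' : InfinitePlace K → (K →+* PadicAlgCl ℓ) := fun w =>
    (ι.symm : ℂ →+* PadicAlgCl ℓ).comp (ComplexEmbedding.conjugate w.embedding) with hτ'
  have hne : ∀ w, τ w ((b : K) / c) ≠ 0 := fun w => (map_ne_zero _).mpr hbc0
  have hne' : ∀ w, τ' w ((b : K) / c) ≠ 0 := fun w => (map_ne_zero _).mpr hbc0
  -- the unit `∏_w τ_w(b/c)^{p_w} τ̄_w(b/c)^{q_w}` lies in the one-units of level `r`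
  set U : (PadicAlgCl ℓ)ˣ := ∏ w : InfinitePlace K,
    (Units.mk0 _ (hne w)) ^ (p w) * (Units.mk0 _ (hne' w)) ^ (q w) with hU
  have hUmem : U ∈ oneUnitsLE (PadicAlgCl ℓ) r hr0 hr1 := by
    refine Subgroup.prod_mem _ fun w _ => Subgroup.mul_mem _ (Subgroup.zpow_mem _ ?_ _) (Subgroup.zpow_mem _ ?_ _)
    · rw [mem_oneUnitsLE_iff, Units.val_mk0]
      exact norm_embedding_div_sub_one_le (τ w) hc hcop hbc
    · rw [mem_oneUnitsLE_iff, Units.val_mk0]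
      exact norm_embedding_div_sub_one_le (τ' w) hc hcop hbc
  have hUval : (U : PadicAlgCl ℓ) =
      ι.symm (∏ w : InfinitePlace K, w.embedding ((b : K) / c) ^ (p w) * conj (w.embedding ((b : K) / c)) ^ (q w)) := by
    rw [hU, Units.coe_prod, map_prod]
    refine Finset.prod_congr rfl fun w _ => ?_
    rw [Units.val_mul, Units.val_zpow_eq_zpow_val, Units.val_zpow_eq_zpow_val, Units.val_mk0, Units.val_mk0,
      map_mul, map_zpow₀, map_zpow₀]
    rfl
  rw [← hUval]
  exact hUmem

end Embeddings

end Literature.NumberTheory.GaloisRepresentations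

end
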